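import Literature.Computability.Cryptography.RegevDGSReductionWorstCase
import Literature.Algebra.EuclideanLattices.SmoothingParameterBounds
import Literature.Algebra.EuclideanLattices.GapCVPPrime
import HarnessLib

/-!
# Regev's quantum reduction, `GapSVP` form: the architecture of the proof of `regev_lwe_to_gapSVP_quantum`

Topic `Computability/Cryptography` (family `pqc`). Companion of `RegevDGSReduction.lean` (which
introduces the quantum `DGS` sampler interface `UniformQCircuitFamily.SamplesDGS`, the bound
`regevDGSBound α ε = √(2n)·η_ε(L)/α` of Regev's Thm 3.1, and proves the SIVP-form assembly
`regev_lwe_to_sivp_quantum_of_dgs`) and of `RegevDGSReductionWorstCase.lean` (Regev's worst-case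
notion `UniformQCircuitFamily.SolvesSearchLWEWorstCase`, the average-case bridge `h₁` and Thm 3.1
as printed `h₂`, `regev_lwe_to_sivp_quantum_of_worstCase`). This file does the same for the
GapSVP form, the named fact
`Literature.Computability.Cryptography.regev_lwe_to_gapSVP_quantum` (pqc.S19; Regev, J. ACM 56
(2009), Thm 1.1), along §3.3 of the paper:

  `LWE` solver ─(Thm 3.1, hypothesis `hB`, SHARED verbatim with the SIVP assembly)→
    sampler for `DGS_{√(2n)·η_ε(L)/α}`, used at `ε = 2⁻ⁿ`
    ─(Lemma 2.11: `η_{2⁻ⁿ}(L) ≤ √n/λ₁(L*)`, PROVED in the tree)→ sampler for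
    `DGS_{√n·γ'(n)/λ₁(L*)}`, `γ' = √(2n)/α`
    ─(Lemma 3.20, hypothesis `hL`)→ decider for `GapCVP′_{100√n·γ'}`
    ─([GMSS99] = Micciancio–Regev 2007, Lemma 5.22, hypothesis `hG`)→ decider for
    `GapSVP_{100√2·n/α}`.

Main content: the PROVED conditional assembly `regev_lwe_to_gapSVP_quantum_of_dgs (hB) (hL) (hG) :
regev_lwe_to_gapSVP_quantum q α m`, with the Lemma 2.11 step
(`Regev2009.regevDGSBound_two_inv_pow_le_dgsBoundDual`, from the tree theorem
`smoothingParameter_two_pow_neg_le_holds`) and the bookkeeping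
`γ = max 1 (100√n · max 1 (√(2n)/α)) = O(n/α)` (`Regev2009.gapSVPFactor`,
`Regev2009.isSoftBigO_gapSVPFactor`). No named fact is introduced (D-0026): `hB`, `hL`, `hG` are
explicit hypotheses, the natural children of a split of pqc.S19 (with `hB` common to both forms).

Also proved: the worst-case variant `regev_lwe_to_gapSVP_quantum_of_worstCase (h₁) (h₂) (hL) (hG)`
with `h₁` (average-case bridge) and `h₂` (Thm 3.1 as printed, oracle = `SolvesSearchLWEWorstCase`
with failure `2^{-cn}`) BYTE-FOR-BYTE the hypotheses of `regev_lwe_to_sivp_quantum_of_worstCase`,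
so that both forms of pqc.S19 share identical children under a split.

## Faithfulness notes

* `hB` is copied from `regev_lwe_to_sivp_quantum_of_dgs` (see the notes there: average-case
  `2/3` solver of pqc.S19 versus Regev's worst-case oracle, bridged inside the paper; arbitrary
  integer modulus, so no `IsPolyBounded q`). Here it is used at the admissible negligible
  `ε(n) = 2⁻ⁿ` (`Regev2009.isNegligible_two_inv_pow`), the instance consumed by Lemma 2.11.
* `hL` — Lemma 3.20 as printed is a classical polynomial-time reduction from
  `GapCVP'_{100√n·γ(n)}` to `DGS_{√n·γ(n)/λ₁(L*)}` for any `γ(n) ≥ 1` (it calls the oracle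
  `N = poly(n)` times at width `1/(100d)` — so no computability of `γ` is needed — and accepts iff
  the Aharonov–Regev verifier `𝒱` rejects). MACHINE FORM: a negligible-error quantum sampler for
  `DGS_{√n·γ(n)/λ₁(L(B)*)}` (`Regev2009.dgsBoundDual`; rational duals are reached from integer
  instances by scaling, `D_{cL,cr} = c·D_{L,r}`) yields a poly-time uniform quantum family deciding
  `GapCVP′_{100√n·γ}` with thresholds `2/3`/`1/3` on all instances of every large dimension. The
  promise sets are the tree's `GapCVP'.yes/no` (MR07 Def. 5.21, whose NO promise also constrains
  odd multiples of the target) ⊆ Regev's Def. 3.19 sets, so `hL` is slightly WEAKER than printed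
  and exactly what MR07 Lemma 5.22 consumes; the `N·ν` loss from inexact samples is negligible.
* `hG` — [GMSS99] as quoted in §3.3 ("for any `γ ≥ 1`, a polynomial time reduction from `GapSVP_γ`
  to `GapCVP'_γ`"); its correctness on the promise is the tree THEOREM
  `MicciancioRegev2007_lemma_5_22` (the `n` calls `(B⁽ⁱ⁾, bᵢ, d)` preserve the dimension).
  MACHINE FORM: a quantum `GapCVP′_γ` decider (eventually in the dimension) yields a quantum
  `GapSVP_γ` decider (eventually in the dimension).
* Both `hL` and `hG` additionally contain the folklore closure of poly-time uniform quantum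
  families under classical poly-time processing of polynomially many independent sub-runs
  (repetition + majority, disjunction; Bennett–Bernstein–Brassard–Vazirani 1997, Thm 4.14;
  Bernstein–Vazirani 1997, Thm 8.3), an infrastructure layer the tree does not have in general
  form yet (compare the infrastructure facts under `ShorTheoremAssembly.lean`).
* Numbering (Def. 2.9, Lemma 2.11, Lemma 3.20, …) is that of the J. ACM paper = the author's
  version arXiv:2401.03703; the tree's `PQCDiscreteGaussian.lean` quotes Lemma 2.11 under an older
  numbering ("Lemma 2.6") — same statement, Micciancio–Regev 2007 Lemma 3.2 in ℓ₂ form.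

NOT here: any named fact; the proofs of `hB` (`h₁`, `h₂`), `hL`, `hG`.

## References

* O. Regev, *On lattices, learning with errors, random linear codes, and cryptography*, J. ACM 56
  (2009), art. 34 (arXiv:2401.03703): §2 (p. 12 "Learning with errors", Def. 2.9, Lemma 2.11),
  Thm 3.1, Lemma 3.6, §3.3 (Defs. 3.18–3.19, Lemma 3.20), Lemmas 4.1, 4.3.
* D. Micciancio, O. Regev, *Worst-case to average-case reductions based on Gaussian measures*,
  SIAM J. Comput. 37 (2007), Lemma 3.2, Def. 5.21, Lemma 5.22.
* O. Goldreich, D. Micciancio, S. Safra, J.-P. Seifert, *Approximating shortest lattice vectors is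
  not harder than approximating closest lattice vectors*, IPL 71 (1999), §3.
* D. Aharonov, O. Regev, *Lattice problems in NP ∩ coNP*, J. ACM 52 (2005), §6 (the verifier `𝒱`).
* C. H. Bennett, E. Bernstein, G. Brassard, U. Vazirani, *Strengths and weaknesses of quantum
  computing*, SIAM J. Comput. 26 (1997), Thm 4.14; E. Bernstein, U. Vazirani, *Quantum complexity
  theory*, ibid., Thm 8.3.
-/

noncomputable section

open Filter Asymptotics Literature.Computability.Complexity Literature.Computability.Cryptography.LWE
  Literature.Algebra.EuclideanLattices
open scoped ENNReal Topology

namespace Literature.Computability.Cryptography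

namespace Regev2009

/-! ### `ε = 2⁻ⁿ`, the `DGS` bound of Lemma 3.20, and the Lemma 2.11 step -/

/-- `ε(n) = 2⁻ⁿ` is negligible (`nᶜ 2⁻ⁿ → 0`); it is an admissible smoothing error for Thm 3.1
and the one of Lemma 2.11. [folklore] -/
theorem isNegligible_two_inv_pow : IsNegligible fun n : ℕ => (2⁻¹ : ℝ) ^ n := by
  intro c
  exact tendsto_pow_const_mul_const_pow_of_abs_lt_one c
    (by rw [abs_of_pos (by positivity)]; norm_num)

/-- The `DGS` bound of Regev's Lemma 3.20: `√n · γ(n) / λ₁(L(B)*)` (dual lattice `dualLattice`,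
minimum distance `minNorm`). [cite: Regev2009, Lemma 3.20] -/
def dgsBoundDual (γ : ℕ → ℝ) (I : LatticeInstance) : ℝ :=
  Real.sqrt I.n * γ I.n / minNorm (dualLattice I.lattice)

/-- **The Lemma 2.11 step of §3.3** (Regev 2009, p. 21: "By using Lemma 2.11, we obtain that under
the assumptions of Theorem 3.1 there exists an efficient quantum algorithm for
`GapCVP'_{O(n/α)}`"): on a nonsingular instance, if `α(n) > 0` and `γ(n) ≥ √(2n)/α(n)` then
`√(2n)·η_{2⁻ⁿ}(L)/α(n) ≤ √n·γ(n)/λ₁(L*)`, by `η_{2⁻ⁿ}(L) ≤ √n/λ₁(L*)` (Lemma 2.11 = MR07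
Lemma 3.2, the tree theorem `smoothingParameter_two_pow_neg_le_holds`). [cite: Regev2009, Lemma 2.11 and §3.3] -/
theorem regevDGSBound_two_inv_pow_le_dgsBoundDual {α γ : ℕ → ℝ} {I : LatticeInstance}
    (hI : I.IsNonsingular) (hα : 0 < α I.n) (hγ : Real.sqrt (2 * I.n) / α I.n ≤ γ I.n) :
    regevDGSBound α (fun n => (2⁻¹ : ℝ) ^ n) I ≤ dgsBoundDual γ I := by
  haveI := LatticeInstance.isZLattice_of_isNonsingular hI
  have h211 := smoothingParameter_two_pow_neg_le_holds I.lattice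
  unfold smoothingParameter_two_pow_neg_le at h211
  rw [finrank_euclideanSpace_fin] at h211
  have hmn : 0 ≤ Real.sqrt I.n / minNorm (dualLattice I.lattice) :=
    div_nonneg (Real.sqrt_nonneg _) (minNorm_nonneg _)
  show Real.sqrt (2 * I.n) * smoothingParameter I.lattice ((2⁻¹ : ℝ) ^ I.n) / α I.n ≤
    Real.sqrt I.n * γ I.n / minNorm (dualLattice I.lattice)
  calc Real.sqrt (2 * I.n) * smoothingParameter I.lattice ((2⁻¹ : ℝ) ^ I.n) / α I.n
      = Real.sqrt (2 * I.n) / α I.n * smoothingParameter I.lattice ((2⁻¹ : ℝ) ^ I.n) := by ring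
    _ ≤ Real.sqrt (2 * I.n) / α I.n * (Real.sqrt I.n / minNorm (dualLattice I.lattice)) :=
        mul_le_mul_of_nonneg_left h211 (div_nonneg (Real.sqrt_nonneg _) hα.le)
    _ ≤ γ I.n * (Real.sqrt I.n / minNorm (dualLattice I.lattice)) :=
        mul_le_mul_of_nonneg_right hγ hmn
    _ = Real.sqrt I.n * γ I.n / minNorm (dualLattice I.lattice) := by ring

/-! ### The approximation factor -/

/-- The `GapSVP` approximation factor delivered by the chain Thm 3.1 → Lemma 2.11 → Lemma 3.20 →
[GMSS99]: `γ(n) = max 1 (100 √n · max 1 (√(2n)/α(n)))`, which equals Regev's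
`100 √n · √(2n)/α(n) = 100√2 · n/α(n) = O(n/α)` as soon as `0 < α(n) < 1 ≤ n`; the two `max 1`
only patch the finitely many dimensions outside the regime (so that `γ ≥ 1` everywhere, as
pqc.S19, Lemma 3.20 and [GMSS99] require). (Regev 2009, §3.3: "`GapSVP_{O(n/α)}`".)
[cite: Regev2009, §3.3] -/
def gapSVPFactor (α : ℕ → ℝ) (n : ℕ) : ℝ :=
  max 1 (100 * Real.sqrt n * max 1 (Real.sqrt (2 * n) / α n))

/-- `1 ≤ γ(n)` for Regev's `GapSVP` factor. [cite: Regev2009, §3.3] -/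
theorem one_le_gapSVPFactor (α : ℕ → ℝ) (n : ℕ) : 1 ≤ gapSVPFactor α n :=
  le_max_left _ _

/-- In the regime `1 ≤ n`, `0 < α(n) < 1`: `γ(n) ≤ 301 · n/α(n)` (crude constant; the exact value
is `100√2 · n/α(n)`). [cite: Regev2009, §3.3] -/
theorem gapSVPFactor_le {α : ℕ → ℝ} {n : ℕ} (hn : 1 ≤ n) (hα : 0 < α n) (hα1 : α n < 1) :
    gapSVPFactor α n ≤ 301 * (n / α n) := by
  have hn' : (1 : ℝ) ≤ n := by exact_mod_cast hn
  have hn0 : (0 : ℝ) ≤ n := by positivity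
  have hsqrt_le : Real.sqrt n ≤ n := by
    rw [Real.sqrt_le_left hn0]
    nlinarith
  have hnα : (n : ℝ) ≤ n / α n := by
    rw [le_div_iff₀ hα]
    nlinarith
  have h2n : Real.sqrt (2 * n) ≤ 2 * Real.sqrt n := by
    rw [Real.sqrt_le_left (by positivity)]
    nlinarith [Real.sq_sqrt hn0]
  have hmax1 : max 1 (Real.sqrt (2 * n) / α n) ≤ 1 + 2 * Real.sqrt n / α n := by
    have h0 : 0 ≤ 2 * Real.sqrt n / α n := div_nonneg (by positivity) hα.le
    refine max_le (by linarith) ?_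
    calc Real.sqrt (2 * n) / α n ≤ 2 * Real.sqrt n / α n :=
          div_le_div_of_nonneg_right h2n hα.le
      _ ≤ 1 + 2 * Real.sqrt n / α n := by linarith
  have hγ₁ : 100 * Real.sqrt n * max 1 (Real.sqrt (2 * n) / α n) ≤ 300 * (n / α n) := by
    calc 100 * Real.sqrt n * max 1 (Real.sqrt (2 * n) / α n)
        ≤ 100 * Real.sqrt n * (1 + 2 * Real.sqrt n / α n) :=
          mul_le_mul_of_nonneg_left hmax1 (by positivity)
      _ = 100 * Real.sqrt n + 200 * ((Real.sqrt n * Real.sqrt n) / α n) := by ring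
      _ = 100 * Real.sqrt n + 200 * (n / α n) := by rw [Real.mul_self_sqrt hn0]
      _ ≤ 100 * (n / α n) + 200 * (n / α n) := by
          have : Real.sqrt n ≤ n / α n := hsqrt_le.trans hnα
          linarith
      _ = 300 * (n / α n) := by ring
  unfold gapSVPFactor
  refine max_le ?_ (hγ₁.trans (by linarith))
  linarith [hn'.trans hnα]

/-- Regev's `GapSVP` factor is `Õ(n/α)` — indeed `O(n/α)` (`k = 0` in `IsSoftBigO`) — in the regime
`α(n) ∈ (0,1)` eventually (Regev 2009, Thm 1.1: "`Õ(n/α)`"; §3.3: "`O(n/α)`" for `GapSVP`).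
[cite: Regev2009, Thm 1.1 and §3.3] -/
theorem isSoftBigO_gapSVPFactor {α : ℕ → ℝ} (hα : ∀ᶠ n : ℕ in atTop, 0 < α n ∧ α n < 1) :
    IsSoftBigO (gapSVPFactor α) fun n => n / α n := by
  refine IsSoftBigO.of_isBigO (IsBigO.of_bound 301 ?_)
  filter_upwards [hα, eventually_ge_atTop 1] with n hn h1
  have hpos : 0 < (n : ℝ) / α n := div_pos (by exact_mod_cast h1) hn.1
  rw [Real.norm_of_nonneg (zero_le_one.trans (one_le_gapSVPFactor α n)),
    Real.norm_of_nonneg hpos.le]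
  exact gapSVPFactor_le h1 hn.1 hn.2

end Regev2009

/-! ### Assembly: pqc.S19 (GapSVP form) from Thm 3.1, Lemma 3.20 and [GMSS99] -/

section Assembly

variable (q : ℕ → ℕ) [∀ n, NeZero (q n)] (α : ℕ → ℝ) (m : ℕ → ℕ)

/-- **Assembly of pqc.S19 (GapSVP form) from Regev's Thm 3.1, Lemma 3.20 and [GMSS99].** The three
hypotheses are machine forms of printed results (NOT proved here; a split of the named fact
`regev_lwe_to_gapSVP_quantum` would vendor them as named facts, `hB` jointly with the SIVP form):

* `hB` — **Thm 3.1 (main theorem)**, VERBATIM the hypothesis `hB` of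
  `regev_lwe_to_sivp_quantum_of_dgs` (see its docstring: printed statement, machine form, the
  in-paper average-case/worst-case bridge, proof DAG Lemmas 3.2–3.14).
* `hL` — **Lemma 3.20**, PRINTED: "For any `γ = γ(n) ≥ 1`, there is a polynomial time reduction
  from `GapCVP'_{100√n·γ(n)}` to `DGS_{√n·γ(n)/λ₁(L*)}`" (call the `DGS` oracle `N = poly(n)` times
  on `(L*, 1/(100d))`, accept iff the Aharonov–Regev verifier `𝒱` rejects; `𝒱` always rejects
  YES instances, and accepts NO instances — where the calls are valid `DGS` instances — with
  probability exponentially close to `1`). MACHINE FORM: a negligible-error quantum sampler for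
  `DGS_{√n·γ(n)/λ₁(L(B)*)}` (`Regev2009.dgsBoundDual`) yields a poly-time uniform quantum family
  accepting YES instances of the tree's `GapCVP′_{100√n·γ}` with probability `≥ 2/3` and NO
  instances with probability `≤ 1/3`, on all instances of every large dimension.
* `hG` — **[GMSS99] (§3.3; Micciancio–Regev 2007, Lemma 5.22)**, PRINTED: "for any `γ ≥ 1`, there
  is a polynomial time reduction from `GapSVP_γ` to `GapCVP'_γ`" (correctness: the tree theorem
  `MicciancioRegev2007_lemma_5_22`). MACHINE FORM: a quantum `GapCVP′_γ` decider as above yields a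
  quantum `GapSVP_γ` decider, both eventually in the dimension.

PROOF (Regev 2009, §3.3, p. 21, made quantitative): `hB` at `ε = 2⁻ⁿ` (negligible,
`isNegligible_two_inv_pow`) gives a sampler for `DGS_{√(2n)η_{2⁻ⁿ}(L)/α}`; by Lemma 2.11
(`regevDGSBound_two_inv_pow_le_dgsBoundDual`, `SamplesDGS.mono`) it samples
`DGS_{√n·γ'(n)/λ₁(L*)}` for `γ' = max 1 (√(2n)/α) ≥ 1`; `hL` gives a decider for
`GapCVP′_{100√n·γ'}`, hence (the NO promise only shrinks, `GapCVP'.no_subset_no_of_le`) for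
`GapCVP′_γ` with `γ = gapSVPFactor α = max 1 (100√n·γ') ≥ 1`; `hG` gives the `GapSVP_γ` decider;
`γ = O(n/α)` is `isSoftBigO_gapSVPFactor`. [cite: Regev2009, Thm 1.1 and §3.3 (Lemma 3.20 with GMSS99)] -/
theorem regev_lwe_to_gapSVP_quantum_of_dgs
    (hB : ∀ (_ : IsPolyBounded m) (_ : IsPolyTimeParams q α m)
      (_ : ∀ᶠ n : ℕ in atTop, 0 < α n ∧ α n < 1 ∧ 2 * Real.sqrt n < α n * q n)
      (_ : ∃ Q : UniformQCircuitFamily, SearchLWESolves q (fun n => discretizedGaussian (q n) (α n))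
        m (fun n => Q.searchLWESolver n (q n) (m n)) fun _ => 2 / 3)
      (ε : ℕ → ℝ), IsNegligible ε → (∀ n, 0 < ε n) →
      ∃ (D : UniformQCircuitFamily) (ν : ℕ → ℝ), IsNegligible ν ∧ D.SamplesDGS (regevDGSBound α ε) ν)
    (hL : ∀ (γ : ℕ → ℝ), (∀ n, 1 ≤ γ n) →
      (∃ (D : UniformQCircuitFamily) (ν : ℕ → ℝ),
          IsNegligible ν ∧ D.SamplesDGS (Regev2009.dgsBoundDual γ) ν) →
      ∃ Q : UniformQCircuitFamily, ∀ᶠ n : ℕ in atTop, ∀ p : GapCVPInstance, p.1.I.n = n →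
        (p ∈ GapCVP'.yes (fun k => 100 * Real.sqrt k * γ k) → 2 / 3 ≤ Q.acceptProb p.encode) ∧
        (p ∈ GapCVP'.no (fun k => 100 * Real.sqrt k * γ k) → Q.acceptProb p.encode ≤ 1 / 3))
    (hG : ∀ (γ : ℕ → ℝ), (∀ n, 1 ≤ γ n) →
      (∃ Q : UniformQCircuitFamily, ∀ᶠ n : ℕ in atTop, ∀ p : GapCVPInstance, p.1.I.n = n →
        (p ∈ GapCVP'.yes γ → 2 / 3 ≤ Q.acceptProb p.encode) ∧
        (p ∈ GapCVP'.no γ → Q.acceptProb p.encode ≤ 1 / 3)) →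
      ∃ Q : UniformQCircuitFamily, ∀ᶠ n : ℕ in atTop, ∀ p : GapSVPInstance, p.1.n = n →
        (p ∈ GapSVP.yes γ → 2 / 3 ≤ Q.acceptProb p.encode) ∧
        (p ∈ GapSVP.no γ → Q.acceptProb p.encode ≤ 1 / 3)) :
    regev_lwe_to_gapSVP_quantum q α m := by
  intro _hq hm hpar hα hLWE
  -- Thm 3.1 at `ε = 2⁻ⁿ`: a quantum sampler for `DGS_{√(2n) η_{2⁻ⁿ}(L)/α}`
  obtain ⟨D, ν, hν, hD⟩ := hB hm hpar hα hLWE (fun n => (2⁻¹ : ℝ) ^ n)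
    Regev2009.isNegligible_two_inv_pow (fun n => by positivity)
  -- Lemma 2.11: hence a sampler for `DGS_{√n γ'(n)/λ₁(L*)}`, `γ' = max 1 (√(2n)/α)`
  set γ' : ℕ → ℝ := fun n => max 1 (Real.sqrt (2 * n) / α n) with hγ'
  have hγ'1 : ∀ n, 1 ≤ γ' n := fun n => le_max_left _ _
  have hD' : D.SamplesDGS (Regev2009.dgsBoundDual γ') ν := by
    refine hD.mono ?_
    filter_upwards [hα] with n hn I hIn hI
    subst hIn
    exact Regev2009.regevDGSBound_two_inv_pow_le_dgsBoundDual hI hn.1 (le_max_right _ _)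
  -- Lemma 3.20: a decider for `GapCVP′_{100 √n γ'}`
  obtain ⟨Q₁, hQ₁⟩ := hL γ' hγ'1 ⟨D, ν, hν, hD'⟩
  -- patch the factor to `γ = max 1 (100 √n γ') ≥ 1` (only the NO promise shrinks)
  have hle : (fun k : ℕ => 100 * Real.sqrt k * γ' k) ≤ Regev2009.gapSVPFactor α :=
    fun k => le_max_right _ _
  have hQ₁' : ∀ᶠ n : ℕ in atTop, ∀ p : GapCVPInstance, p.1.I.n = n →
      (p ∈ GapCVP'.yes (Regev2009.gapSVPFactor α) → 2 / 3 ≤ Q₁.acceptProb p.encode) ∧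
      (p ∈ GapCVP'.no (Regev2009.gapSVPFactor α) → Q₁.acceptProb p.encode ≤ 1 / 3) := by
    filter_upwards [hQ₁] with n hn p hp
    refine ⟨fun hyes => (hn p hp).1 ?_, fun hno => (hn p hp).2 (GapCVP'.no_subset_no_of_le hle hno)⟩
    rwa [GapCVP'.yes_eq_yes _ (Regev2009.gapSVPFactor α)]
  -- [GMSS99]: a decider for `GapSVP_γ`
  obtain ⟨Q₂, hQ₂⟩ := hG (Regev2009.gapSVPFactor α) (Regev2009.one_le_gapSVPFactor α) ⟨Q₁, hQ₁'⟩
  exact ⟨Regev2009.gapSVPFactor α, Regev2009.one_le_gapSVPFactor α,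
    Regev2009.isSoftBigO_gapSVPFactor (hα.mono fun n hn => ⟨hn.1, hn.2.1⟩), Q₂, hQ₂⟩

/-- **The same assembly with Thm 3.1 in Regev's worst-case form**: `hB` split — as a faithful
vendoring of the printed results requires — into `h₁`, the AVERAGE-CASE BRIDGE (shift
`(a,b) ↦ (a, b + ⟨a,t⟩)` of the proof of Lemma 4.1, `n`-fold repetition, verification by
Lemma 3.6: the `2/3` average-case solver of pqc.S19 yields a family solving `LWE_{q,Ψ̄_α}` for
EVERY secret with failure `2^{-cn}`, `UniformQCircuitFamily.SolvesSearchLWEWorstCase`, on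
polynomially many poly-time computable samples), and `h₂`, **Thm 3.1 as printed** (with
Lemma 4.3 for the discretised oracle): both BYTE-FOR-BYTE the hypotheses `h₁`, `h₂` of
`regev_lwe_to_sivp_quantum_of_worstCase` (`RegevDGSReductionWorstCase.lean`, see the faithfulness
notes there); `hL`, `hG` as in `regev_lwe_to_gapSVP_quantum_of_dgs`. The proof composes `h₁`, `h₂`
into `hB`. [cite: Regev2009, Thm 3.1 (with §2 p. 12, Lemmas 3.6, 4.1, 4.3), Lemma 3.20 and §3.3] -/
theorem regev_lwe_to_gapSVP_quantum_of_worstCase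
    (h₁ : ∀ (_ : IsPolyBounded m) (_ : IsPolyTimeParams q α m)
      (_ : ∀ᶠ n : ℕ in atTop, 0 < α n ∧ α n < 1 ∧ 2 * Real.sqrt n < α n * q n)
      (_ : ∃ Q : UniformQCircuitFamily, SearchLWESolves q (fun n => discretizedGaussian (q n) (α n))
        m (fun n => Q.searchLWESolver n (q n) (m n)) fun _ => 2 / 3),
      ∃ (W : UniformQCircuitFamily) (m' : ℕ → ℕ) (c : ℝ), IsPolyBounded m' ∧
        IsPolyTimeParams q α m' ∧ 0 < c ∧
        W.SolvesSearchLWEWorstCase q (fun n => discretizedGaussian (q n) (α n)) m'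
          fun n => (2 : ℝ) ^ (-(c * n)))
    (h₂ : ∀ (m' : ℕ → ℕ) (_ : IsPolyBounded m') (_ : IsPolyTimeParams q α m')
      (_ : ∀ᶠ n : ℕ in atTop, 0 < α n ∧ α n < 1 ∧ 2 * Real.sqrt n < α n * q n)
      (_ : ∃ (W : UniformQCircuitFamily) (c : ℝ), 0 < c ∧
        W.SolvesSearchLWEWorstCase q (fun n => discretizedGaussian (q n) (α n)) m'
          fun n => (2 : ℝ) ^ (-(c * n)))
      (ε : ℕ → ℝ), IsNegligible ε → (∀ n, 0 < ε n) →
      ∃ (D : UniformQCircuitFamily) (ν : ℕ → ℝ), IsNegligible ν ∧ D.SamplesDGS (regevDGSBound α ε) ν)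
    (hL : ∀ (γ : ℕ → ℝ), (∀ n, 1 ≤ γ n) →
      (∃ (D : UniformQCircuitFamily) (ν : ℕ → ℝ),
          IsNegligible ν ∧ D.SamplesDGS (Regev2009.dgsBoundDual γ) ν) →
      ∃ Q : UniformQCircuitFamily, ∀ᶠ n : ℕ in atTop, ∀ p : GapCVPInstance, p.1.I.n = n →
        (p ∈ GapCVP'.yes (fun k => 100 * Real.sqrt k * γ k) → 2 / 3 ≤ Q.acceptProb p.encode) ∧
        (p ∈ GapCVP'.no (fun k => 100 * Real.sqrt k * γ k) → Q.acceptProb p.encode ≤ 1 / 3))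
    (hG : ∀ (γ : ℕ → ℝ), (∀ n, 1 ≤ γ n) →
      (∃ Q : UniformQCircuitFamily, ∀ᶠ n : ℕ in atTop, ∀ p : GapCVPInstance, p.1.I.n = n →
        (p ∈ GapCVP'.yes γ → 2 / 3 ≤ Q.acceptProb p.encode) ∧
        (p ∈ GapCVP'.no γ → Q.acceptProb p.encode ≤ 1 / 3)) →
      ∃ Q : UniformQCircuitFamily, ∀ᶠ n : ℕ in atTop, ∀ p : GapSVPInstance, p.1.n = n →
        (p ∈ GapSVP.yes γ → 2 / 3 ≤ Q.acceptProb p.encode) ∧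
        (p ∈ GapSVP.no γ → Q.acceptProb p.encode ≤ 1 / 3)) :
    regev_lwe_to_gapSVP_quantum q α m := by
  refine regev_lwe_to_gapSVP_quantum_of_dgs q α m (fun hm hpar hα hLWE ε hε hε0 => ?_) hL hG
  obtain ⟨W, m', c, hm', hpar', hc, hW⟩ := h₁ hm hpar hα hLWE
  exact h₂ m' hm' hpar' hα ⟨W, c, hc, hW⟩ ε hε hε0

end Assembly

end Literature.Computability.Cryptography

end
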